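import Mathlib.LinearAlgebra.Matrix.Determinant.Basic
import Mathlib.GroupTheory.Perm.Cycle.Factors
import HarnessLib

/-!
# Expansion of a determinant along the cycles through a fixed index

The Leibniz sum `det A = ∑_σ sgn σ ∏_i A_{σ(i) i}` regrouped by the cycle `z = σ.cycleOf v` of the
permutation through a fixed index `v` (the coefficients theorem for weighted digraphs,
Cvetković–Doob–Sachs §1.4 Thm 1.2 and (1.35*): `det A` is the signed sum over linear directed
subgraphs `L` of `∏(L)`; here the linear subgraphs are classified by their component through `v`):

  `det A = ∑_{z : z.cycleOf v = z} sgn z · (∏_{i ∈ {v} ∪ supp z} A_{z(i) i}) · det A[({v} ∪ supp z)ᶜ]`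

(`det_eq_sum_cycleOf`), the sum running over `z = 1` (contributing `A_{vv} det A[vᶜ]`) and the cyclic
permutations `z` through `v` (contributing `sgn z ∏_{i ∈ supp z} A_{z(i) i} det A[(supp z)ᶜ]`, i.e.
`(-1)^{ℓ-1}` times the weight of the directed cycle `v → z v → ⋯ → v` of length `ℓ` times the
complementary minor).  The fibre of `σ ↦ σ.cycleOf v` over `z` is `{τ' z : τ' fixes {v} ∪ supp z
pointwise}` (`cycleOf_mul_of_fix`, `mul_inv_cycleOf_fix`), and the permutations fixing a set
pointwise give the complementary principal minor (`sum_perm_fix_eq_det_submatrix`).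

## References

* D. M. Cvetković, M. Doob, H. Sachs, *Spectra of Graphs* (1980/1995), §1.4 Theorem 1.2 and (1.35*)
  (held text `book:cvetkovic1995-spectra-graphs-theory-application`, p0026–p0028). [CvetkovicDoobSachs1980]
* N. Biggs, *Algebraic Graph Theory* (1974), Proposition 7.2. [Biggs1974]
-/

namespace Literature.LinearAlgebra.Matrix

open Finset Equiv Equiv.Perm

variable {n : Type*} [Fintype n] [DecidableEq n] {R : Type*} [CommRing R]

/-! ### Permutations fixing a set pointwise and the complementary principal minor -/

omit [Fintype n] [DecidableEq n] in
/-- A permutation fixing every point outside `p` preserves `p`. [cite: Biggs1974, Proposition 7.2] -/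
theorem apply_iff_of_fix {p : n → Prop} {τ : Perm n} (hfix : ∀ x, ¬p x → τ x = x) (x : n) : p (τ x) ↔ p x := by
  constructor
  · intro hpx
    by_contra hx
    rw [hfix x hx] at hpx
    exact hx hpx
  · intro hx
    by_contra hpx
    have h1 : τ (τ x) = τ x := hfix _ hpx
    rw [τ.injective h1] at hpx
    exact hpx hx

/-- **The permutations fixing the complement of `p` pointwise give the principal minor on `p`**:
`∑_{τ : τ = id off p} sgn τ ∏_{i : p i} A_{τ(i) i} = det A[p]`. [cite: CvetkovicDoobSachs1980, §1.4 Thm 1.2] -/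
theorem sum_perm_fix_eq_det_submatrix (A : Matrix n n R) (p : n → Prop) [DecidablePred p] :
    ∑ τ ∈ univ.filter (fun τ : Perm n => ∀ x, ¬p x → τ x = x),
        ((Perm.sign τ : ℤ) : R) * ∏ i ∈ univ.filter p, A (τ i) i =
      (A.submatrix (Subtype.val : {x // p x} → n) Subtype.val).det := by
  rw [Matrix.det_apply']
  symm
  refine Finset.sum_bij' (fun π _ => Perm.ofSubtype π)
    (fun τ hτ => τ.subtypePerm (fun x => apply_iff_of_fix (mem_filter.1 hτ).2 x))
    (fun π _ => mem_filter.2 ⟨mem_univ _, fun x hx => Perm.ofSubtype_apply_of_not_mem π hx⟩)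
    (fun τ _ => mem_univ _) (fun π _ => ?_) (fun τ hτ => ?_) (fun π _ => ?_)
  · exact Equiv.ext fun y => Subtype.ext (by
      show Perm.ofSubtype π (y : n) = ↑(π y)
      exact Perm.ofSubtype_apply_coe π y)
  · obtain ⟨-, hfix⟩ := mem_filter.1 hτ
    exact Perm.ofSubtype_subtypePerm _ fun x hx => by
      by_contra hpx
      exact hx (hfix x hpx)
  · rw [Perm.sign_ofSubtype, Finset.prod_subtype (p := p) (univ.filter p) (fun x => by simp)]
    refine congrArg _ (Fintype.prod_congr _ _ fun i => ?_)
    rw [Matrix.submatrix_apply, Perm.ofSubtype_apply_coe]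

/-! ### The cycle through `v` and the rest -/

/-- On the support of its cycle through `v`, `σ` agrees with that cycle. [cite: Biggs1974, Proposition 7.2] -/
theorem apply_eq_cycleOf_apply {σ : Perm n} {v x : n} (hx : (σ.cycleOf v) x ≠ x) : σ x = (σ.cycleOf v) x := by
  have hsame : σ.SameCycle v x := (mem_support_cycleOf_iff.1 (Perm.mem_support.2 hx)).1
  rw [cycleOf_apply, if_pos hsame]

/-- The cycle through `v` maps `{v} ∪ supp` into itself. [cite: Biggs1974, Proposition 7.2] -/
theorem cycleOf_apply_mem_insert_support (σ : Perm n) (v i : n) (hi : i ∈ insert v (σ.cycleOf v).support) :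
    (σ.cycleOf v) i ∈ insert v (σ.cycleOf v).support := by
  by_cases h : (σ.cycleOf v) i = i
  · rwa [h]
  · exact mem_insert_of_mem (Perm.apply_mem_support.2 (Perm.mem_support.2 h))

/-- **Removing the cycle through `v`**: `σ · (σ.cycleOf v)⁻¹` fixes `{v} ∪ supp (σ.cycleOf v)`
pointwise. [cite: CvetkovicDoobSachs1980, §1.4 Thm 1.2] -/
theorem mul_inv_cycleOf_fix (σ : Perm n) (v x : n) (hx : x ∈ insert v (σ.cycleOf v).support) :
    (σ * (σ.cycleOf v)⁻¹) x = x := by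
  set z := σ.cycleOf v with hz
  by_cases hzx : z x = x
  · -- then `x = v` with `σ v = v`
    have hxv : x = v := by
      rcases mem_insert.1 hx with h | h
      · exact h
      · exact absurd hzx (Perm.mem_support.1 h)
    subst hxv
    have hσ : σ x = x := by rwa [hz, cycleOf_apply_self] at hzx
    rw [Perm.mul_apply, show z⁻¹ x = x from by rw [Perm.inv_eq_iff_eq]; exact hzx.symm, hσ]
  · rw [Perm.mul_apply]
    have hzz : z (z⁻¹ x) = x := z.apply_symm_apply x
    have hy : z (z⁻¹ x) ≠ z⁻¹ x := by
      rw [hzz]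
      intro h
      apply hzx
      conv_lhs => rw [h]
      exact hzz
    rw [apply_eq_cycleOf_apply hy, hzz]

/-- `z = σ.cycleOf v` is its own cycle through `v`. [cite: Biggs1974, Proposition 7.2] -/
theorem cycleOf_cycleOf_self (σ : Perm n) (v : n) : (σ.cycleOf v).cycleOf v = σ.cycleOf v := by
  by_cases hv : σ v = v
  · rw [(cycleOf_eq_one_iff σ).2 hv, cycleOf_one]
  · exact (σ.isCycle_cycleOf hv).cycleOf_eq (by rwa [cycleOf_apply_self])

/-- **Putting the cycle back**: if `z.cycleOf v = z` and `τ'` fixes `{v} ∪ supp z` pointwise then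
`(τ' z).cycleOf v = z`. [cite: CvetkovicDoobSachs1980, §1.4 Thm 1.2] -/
theorem cycleOf_mul_of_fix {z τ' : Perm n} {v : n} (hz : z.cycleOf v = z)
    (hfix : ∀ x, x ∈ insert v z.support → τ' x = x) : (τ' * z).cycleOf v = z := by
  have hdisj : τ'.Disjoint z := fun x => by
    by_cases hx : z x = x
    · exact Or.inr hx
    · exact Or.inl (hfix x (mem_insert_of_mem (Perm.mem_support.2 hx)))
  rw [hdisj.cycleOf_mul_distrib, (cycleOf_eq_one_iff τ').2 (hfix v (mem_insert_self _ _)), one_mul, hz]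

/-- The product formula on the fibre: for `τ'` fixing `F = {v} ∪ supp z` pointwise (`z.cycleOf v = z`),
`∏_i A_{(τ'z)(i) i} = ∏_{i ∈ F} A_{z(i) i} · ∏_{i ∉ F} A_{τ'(i) i}`. [cite: CvetkovicDoobSachs1980, §1.4 (1.35*)] -/
theorem prod_mul_cycle_eq {z τ' : Perm n} {v : n} (hz : z.cycleOf v = z)
    (hfix : ∀ x, x ∈ insert v z.support → τ' x = x) (A : Matrix n n R) :
    ∏ i, A ((τ' * z) i) i =
      (∏ i ∈ insert v z.support, A (z i) i) * ∏ i ∈ univ.filter (fun i => i ∉ insert v z.support), A (τ' i) i := by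
  rw [← Finset.prod_filter_mul_prod_filter_not univ (fun i => i ∈ insert v z.support)]
  congr 1
  · rw [Finset.filter_mem_eq_inter, Finset.univ_inter]
    refine Finset.prod_congr rfl fun i hi => ?_
    rw [Perm.mul_apply, hfix (z i) (by rw [← hz] at hi ⊢; exact cycleOf_apply_mem_insert_support z v i hi)]
  · refine Finset.prod_congr rfl fun i hi => ?_
    have hi' : i ∉ insert v z.support := (mem_filter.1 hi).2
    rw [Perm.mul_apply, Perm.notMem_support.1 fun h => hi' (mem_insert_of_mem h)]

/-- **EXPANSION OF THE DETERMINANT ALONG THE CYCLES THROUGH `v`**: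
`det A = ∑_{z : z.cycleOf v = z} sgn z (∏_{i ∈ {v} ∪ supp z} A_{z(i) i}) det A[({v} ∪ supp z)ᶜ]` — the
term `z = 1` is `A_{vv} det A[vᶜ]`, the others run over the cyclic permutations through `v`
(the coefficients theorem for weighted digraphs, grouped by the cycle through `v`). [cite: CvetkovicDoobSachs1980, §1.4 Thm 1.2 & (1.35*)] -/
theorem det_eq_sum_cycleOf (A : Matrix n n R) (v : n) :
    A.det = ∑ z ∈ univ.filter (fun z : Perm n => z.cycleOf v = z),
      ((Perm.sign z : ℤ) : R) * (∏ i ∈ insert v z.support, A (z i) i) *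
        (A.submatrix (Subtype.val : {x // x ∉ insert v z.support} → n) Subtype.val).det := by
  rw [Matrix.det_apply', ← Finset.sum_fiberwise_of_maps_to
    (s := (univ : Finset (Perm n))) (t := univ.filter (fun z : Perm n => z.cycleOf v = z))
    (g := fun σ : Perm n => σ.cycleOf v) (fun σ _ => mem_filter.2 ⟨mem_univ _, cycleOf_cycleOf_self σ v⟩)]
  refine Finset.sum_congr rfl fun z hz => ?_
  have hzz : z.cycleOf v = z := (mem_filter.1 hz).2
  rw [← sum_perm_fix_eq_det_submatrix A (fun x => x ∉ insert v z.support), Finset.mul_sum]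
  -- reindex the fibre by `τ' ↦ τ' * z`
  symm
  refine Finset.sum_nbij' (fun τ' => τ' * z) (fun σ => σ * z⁻¹) (fun τ' hτ' => ?_) (fun σ hσ => ?_)
    (fun τ' _ => mul_inv_cancel_right τ' z) (fun σ _ => inv_mul_cancel_right σ z) (fun τ' hτ' => ?_)
  · have hfix : ∀ x, x ∈ insert v z.support → τ' x = x := fun x hx =>
      (mem_filter.1 hτ').2 x (not_not.2 hx)
    exact mem_filter.2 ⟨mem_univ _, cycleOf_mul_of_fix hzz hfix⟩
  · have hσz : σ.cycleOf v = z := (mem_filter.1 hσ).2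
    refine mem_filter.2 ⟨mem_univ _, fun x hx => ?_⟩
    rw [not_not] at hx
    rw [← hσz] at hx ⊢
    exact mul_inv_cycleOf_fix σ v x hx
  · have hfix : ∀ x, x ∈ insert v z.support → τ' x = x := fun x hx =>
      (mem_filter.1 hτ').2 x (not_not.2 hx)
    rw [prod_mul_cycle_eq hzz hfix A, Perm.sign_mul, Units.val_mul, Int.cast_mul]
    ring

/-- The index set of the expansion without its trivial element consists of the cyclic permutations
through `v`: `z.cycleOf v = z ∧ z v ≠ v ↔ z.IsCycle ∧ z v ≠ v`. [cite: Biggs1974, Proposition 7.2] -/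
theorem cycleOf_eq_self_and_ne_iff (z : Perm n) (v : n) : (z.cycleOf v = z ∧ z v ≠ v) ↔ (z.IsCycle ∧ z v ≠ v) := by
  constructor
  · rintro ⟨hz, hv⟩
    exact ⟨by rw [← hz]; exact z.isCycle_cycleOf hv, hv⟩
  · rintro ⟨hc, hv⟩
    exact ⟨hc.cycleOf_eq hv, hv⟩

/-- **The cycle expansion for a matrix with zero diagonal**: the `z = 1` term drops and
`det A = ∑_{z cyclic through v} sgn z (∏_{i ∈ supp z} A_{z(i) i}) det A[(supp z)ᶜ]` (the cyclic `z`
through `v` being the `z` with `z.cycleOf v = z`, `z v ≠ v`, `cycleOf_eq_self_and_ne_iff`). [cite: CvetkovicDoobSachs1980, §1.4 Thm 1.2 & (1.35*)] -/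
theorem det_eq_sum_cycle_of_diag_eq_zero (A : Matrix n n R) (hA : ∀ i, A i i = 0) (v : n) :
    A.det = ∑ z ∈ univ.filter (fun z : Perm n => z.cycleOf v = z ∧ z v ≠ v),
      ((Perm.sign z : ℤ) : R) * (∏ i ∈ z.support, A (z i) i) *
        (A.submatrix (Subtype.val : {x // x ∉ z.support} → n) Subtype.val).det := by
  rw [det_eq_sum_cycleOf A v]
  have hsplit : univ.filter (fun z : Perm n => z.cycleOf v = z) =
      insert 1 (univ.filter (fun z : Perm n => z.cycleOf v = z ∧ z v ≠ v)) := by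
    ext z
    simp only [mem_filter, mem_univ, true_and, mem_insert]
    constructor
    · intro hz
      by_cases hv : z v = v
      · exact Or.inl (by rw [← hz]; exact (cycleOf_eq_one_iff z).2 hv)
      · exact Or.inr ⟨hz, hv⟩
    · rintro (rfl | ⟨hz, -⟩)
      · exact cycleOf_one v
      · exact hz
  have h1 : (1 : Perm n) ∉ univ.filter (fun z : Perm n => z.cycleOf v = z ∧ z v ≠ v) := by simp
  rw [hsplit, Finset.sum_insert h1, Perm.support_one, insert_empty_eq, Finset.prod_singleton, Perm.one_apply,
    hA v, mul_zero, zero_mul, zero_add]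
  refine Finset.sum_congr rfl fun z hz => ?_
  obtain ⟨-, hv⟩ := (mem_filter.1 hz).2
  rw [insert_eq_of_mem (Perm.mem_support.2 hv)]

end Literature.LinearAlgebra.Matrix
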